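import Mathlib.Analysis.Complex.Exponential
import Mathlib.Analysis.SpecialFunctions.Exp

/-!
# Route `JensenPolynomials`, FAR crux `XiWindowZeroFreeRelFar` (B1-rel far), stub S3 `stub_laplaceFar` — WANTED (L3)
`wanted_descent`: the two ONE-VARIABLE real facts (RH-FREE; cell rh-jensen, HUMAN RULING D-0040 / D-0074)

LINE 1 (D-0074 framing): RH-FREE; two elementary inequalities for the real exponential on explicit ranges; nothing here bears
on the zeros of `ζ` or is progress toward RH.

eng-5 g4's architecture for (L3) (STATUS 2026-08-26T17:14:04Z; S3 lead eng-4 g3's ruling 17:19:52Z hands these two facts to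
this seat, texts as posted) reduces the LEFT/RIGHT descent of `Re Ψ` along the horizontal line through a saddle-disc point to

* LEFT  (`descent_left_oneVar`):  `e^{−4s} − 1 + 3.957·s − 1.03·s² ≥ 0.0029` for `s ∈ [1/30, 2.13]`
  (true minimum `0.00593` at `s = 1/30`; proved on `[1/30, 3]`). Proof: on `[1/30, 1/4]` the Taylor bound
  `e^{−4s} ≥ 1 − 4s + 8s² − (32/3)s³ − (40/3)s⁴` (Mathlib `Real.exp_bound`, `n = 4`); on `[1/4, 1/2]` `e^{−4s} ≥ (1 − 2s)²`
  (`Real.add_one_le_exp` squared); beyond `1/2`, `e^{−4s} ≥ 0` and `−1.03s² + 3.957s − 1.0029 ≥ 0` up to `s = 3`.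
* RIGHT (`descent_right_oneVar`): `e^{4t} − 1 − 4t − 0.043·t − t²/4 − 0.78·t²(1 + t/18)² ≥ 6.97·t² − 0.043·t` for every
  `t ≥ 0` (in particular `t ≥ 1/30`). Proof: `e^{4t} = (e^{2t})² ≥ (1 + 2t + 2t²)² = 1 + 4t + 8t² + 8t³ + 4t⁴`
  (Mathlib `Real.quadratic_le_exp_of_nonneg` squared) and `8t² = t²/4 + 0.78t² + 6.97t²`, `8t³ + 4t⁴ ≥ 0.78t²(t/9 + t²/324)`.

Constants are stated as exact rationals (`3957/1000`, `103/100`, `29/10000`, `213/100`, `43/1000`, `39/50`, `697/100`).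
WHAT THIS IS NOT: nothing about `ξ` or `ζ`. References: theory g8's S3-BLUEPRINT §3 (D1)–(D3); eng-4 g3's S3 WANTED list v3
(HOME `eng-4/S3/S3-WANTED.lean`, sha16 `d6f8107cd04d985a`); GORZ 2019 [GORZPNAS2019].
-/

noncomputable section
-- D-0017: `Summit.RiemannHypothesis.RiemannHypothesis.…` duplicates the namespace BY DESIGN (single-problem summit).
set_option linter.dupNamespace false

namespace Summit.RiemannHypothesis.RiemannHypothesis.Theorems.JensenPolynomials.FarGumbel

open Real Finset

/-! ## 1. Exponential lower bounds -/

/-- Taylor with remainder at order four: `e^{−4s} ≥ 1 − 4s + 8s² − (32/3)s³ − (40/3)s⁴` for `0 ≤ s ≤ 1/4`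
(Mathlib `Real.exp_bound` with `n = 4`: `|e^x − (1 + x + x²/2 + x³/6)| ≤ |x|⁴·5/96`, `x = −4s`). -/
theorem exp_neg_four_mul_ge_taylor {s : ℝ} (hs0 : 0 ≤ s) (hs1 : s ≤ 1 / 4) :
    1 - 4 * s + 8 * s ^ 2 - 32 / 3 * s ^ 3 - 40 / 3 * s ^ 4 ≤ Real.exp (-4 * s) := by
  have hx : |(-4 * s : ℝ)| ≤ 1 := by rw [abs_le]; constructor <;> linarith
  have h := Real.exp_bound hx (n := 4) (by norm_num)
  have hsum : ∑ m ∈ range 4, (-4 * s) ^ m / (m.factorial : ℝ) = 1 - 4 * s + 8 * s ^ 2 - 32 / 3 * s ^ 3 := by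
    simp only [Finset.sum_range_succ, Finset.sum_range_zero, Nat.factorial]
    push_cast
    ring
  have habs : |(-4 * s : ℝ)| = 4 * s := by rw [abs_of_nonpos (by linarith)]; ring
  rw [hsum, habs] at h
  have h' := (abs_le.1 h).1
  norm_num [Nat.factorial] at h'
  have h5 : (4 * s) ^ 4 * (5 / 96 : ℝ) = 40 / 3 * s ^ 4 := by ring
  have e : (-4 * s : ℝ) = -(4 * s) := by ring
  rw [e]
  linarith [h', h5]

/-- `e^{−4s} ≥ (1 − 2s)²` for `s ≤ 1/2` (`1 − 2s ≤ e^{−2s}`, both sides nonnegative, squared). -/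
theorem exp_neg_four_mul_ge_sq {s : ℝ} (hs1 : s ≤ 1 / 2) : (1 - 2 * s) ^ 2 ≤ Real.exp (-4 * s) := by
  have h1 : 1 - 2 * s ≤ Real.exp (-2 * s) := by have := Real.add_one_le_exp (-2 * s); linarith
  have h0 : 0 ≤ 1 - 2 * s := by linarith
  have h2 : (1 - 2 * s) ^ 2 ≤ Real.exp (-2 * s) ^ 2 := pow_le_pow_left₀ h0 h1 2
  have h3 : Real.exp (-2 * s) ^ 2 = Real.exp (-4 * s) := by rw [← Real.exp_nat_mul]; ring_nf
  rw [← h3]; exact h2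

/-- `e^{4t} ≥ (1 + 2t + 2t²)² = 1 + 4t + 8t² + 8t³ + 4t⁴` for `t ≥ 0` (`1 + 2t + 2t² ≤ e^{2t}` squared). -/
theorem exp_four_mul_ge_sq {t : ℝ} (ht : 0 ≤ t) : (1 + 2 * t + 2 * t ^ 2) ^ 2 ≤ Real.exp (4 * t) := by
  have h1 : 1 + 2 * t + (2 * t) ^ 2 / 2 ≤ Real.exp (2 * t) := Real.quadratic_le_exp_of_nonneg (by linarith)
  have h1' : 1 + 2 * t + 2 * t ^ 2 ≤ Real.exp (2 * t) := by
    have e : (2 * t) ^ 2 / 2 = 2 * t ^ 2 := by ring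
    linarith [e ▸ h1]
  have h0 : 0 ≤ 1 + 2 * t + 2 * t ^ 2 := by positivity
  have h2 := pow_le_pow_left₀ h0 h1' 2
  have h3 : Real.exp (2 * t) ^ 2 = Real.exp (4 * t) := by rw [← Real.exp_nat_mul]; ring_nf
  rw [← h3]; exact h2

/-! ## 2. The two one-variable facts of (L3) -/

/-- **LEFT one-variable fact** (eng-5 g4's (L3) architecture, text as posted, range extended to `s ≤ 3`):
`e^{−4s} − 1 + 3.957s − 1.03s² ≥ 0.0029` for `1/30 ≤ s ≤ 3` (true minimum `0.00593…` at `s = 1/30`). -/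
theorem descent_left_oneVar_ext {s : ℝ} (hs1 : 1 / 30 ≤ s) (hs2 : s ≤ 3) :
    29 / 10000 ≤ Real.exp (-4 * s) - 1 + 3957 / 1000 * s - 103 / 100 * s ^ 2 := by
  have hs0 : 0 ≤ s := by linarith
  rcases le_or_gt s (1 / 4) with hA | hA
  · -- `s ≤ 1/4`: order-four Taylor bound
    have hT := exp_neg_four_mul_ge_taylor hs0 hA
    rcases le_or_gt s (3 / 20) with hA1 | hA1
    · -- `s ≤ 3/20`: `s³ ≤ (3/20)s²`, `s⁴ ≤ (3/20)²s²`, then `s(5.07s − 0.043) ≥ (1/30)·0.126`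
      have h3 : s ^ 3 ≤ 3 / 20 * s ^ 2 := by nlinarith [sq_nonneg s]
      have h4 : s ^ 4 ≤ (3 / 20) ^ 2 * s ^ 2 := by nlinarith [sq_nonneg s, mul_nonneg hs0 hs0]
      nlinarith [mul_le_mul hs1 hs1 (by norm_num) hs0]
    · -- `3/20 < s ≤ 1/4`
      have h3 : s ^ 3 ≤ 1 / 4 * s ^ 2 := by nlinarith [sq_nonneg s]
      have h4 : s ^ 4 ≤ (1 / 4) ^ 2 * s ^ 2 := by nlinarith [sq_nonneg s, mul_nonneg hs0 hs0]
      have h2 : (3 / 20) ^ 2 ≤ s ^ 2 := by nlinarith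
      nlinarith
  · rcases le_or_gt s (1 / 2) with hB | hB
    · -- `1/4 < s ≤ 1/2`: `(1 − 2s)² ≤ e^{−4s}`
      have hT := exp_neg_four_mul_ge_sq hB
      nlinarith [mul_le_mul hA.le hA.le (by norm_num) hs0]
    · -- `s > 1/2`: drop the exponential
      have hT : 0 ≤ Real.exp (-4 * s) := (Real.exp_pos _).le
      nlinarith [mul_nonneg (sub_nonneg.2 hB.le) (sub_nonneg.2 hs2)]

/-- **LEFT one-variable fact, text as posted**: `e^{−4s} − 1 + 3.957s − 1.03s² ≥ 0.0029` for `s ∈ [1/30, 2.13]`. -/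
theorem descent_left_oneVar {s : ℝ} (hs1 : 1 / 30 ≤ s) (hs2 : s ≤ 213 / 100) :
    29 / 10000 ≤ Real.exp (-4 * s) - 1 + 3957 / 1000 * s - 103 / 100 * s ^ 2 :=
  descent_left_oneVar_ext hs1 (by linarith)

/-- **RIGHT one-variable fact** (eng-5 g4's (L3) architecture), for every `t ≥ 0`:
`e^{4t} − 1 − 4t − 0.043t − t²/4 − 0.78t²(1 + t/18)² ≥ 6.97t² − 0.043t`. -/
theorem descent_right_oneVar_of_nonneg {t : ℝ} (ht : 0 ≤ t) :
    697 / 100 * t ^ 2 - 43 / 1000 * t ≤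
      Real.exp (4 * t) - 1 - 4 * t - 43 / 1000 * t - t ^ 2 / 4 - 39 / 50 * t ^ 2 * (1 + t / 18) ^ 2 := by
  have hT := exp_four_mul_ge_sq ht
  nlinarith [pow_nonneg ht 3, pow_nonneg ht 4]

/-- **RIGHT one-variable fact, text as posted**: for `t ≥ 1/30`,
`e^{4t} − 1 − 4t − 0.043t − t²/4 − 0.78t²(1 + t/18)² ≥ 6.97t² − 0.043t`. -/
theorem descent_right_oneVar {t : ℝ} (ht : 1 / 30 ≤ t) :
    697 / 100 * t ^ 2 - 43 / 1000 * t ≤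
      Real.exp (4 * t) - 1 - 4 * t - 43 / 1000 * t - t ^ 2 / 4 - 39 / 50 * t ^ 2 * (1 + t / 18) ^ 2 :=
  descent_right_oneVar_of_nonneg (by linarith)

end Summit.RiemannHypothesis.RiemannHypothesis.Theorems.JensenPolynomials.FarGumbel

end
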